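import Summits.QuantumAdvantage.QuantumAdvantage.Theses.Dequantize

/-!
# STRATEGY CENSUS sketch — crux `Dequantize.DeqStabrankPolyUniform` (stmt-QuantumAdvantage-1036)

Typed candidate DECOMPOSITIONS `X ⇐ X₁ ∧ … ∧ X_k` of the RESTATED deciding crux
`X := DeqStabrankPolyUniform` (P-uniform, jointly-polynomial δ-approximate stabilizer decompositions of
`|T⟩^{⊗t}` at every precision `δ = 1/(k+1)`), written over existing declarations so that each piece
elaborates, with the seams that are pure logic PROVED.  Companion of `STRATEGY-CENSUS.md` (same crux
directory), which records for each split which of the BC2-redirect conditions (a)–(d) fails.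
Nothing here is a route item; nothing here is proposed to `Theorems/`.
-/

noncomputable section

set_option linter.dupNamespace false

namespace Summit.QuantumAdvantage.QuantumAdvantage.Cruxes.DeqStabrankPolyUniform.Census

open Literature.Computability.Cryptography Literature.Computability.Complexity
open Literature.Computability.QuantumComplexity
open Summit.QuantumAdvantage.QuantumAdvantage.Theses.Dequantize

/-- The crux under audit, by name. -/
abbrev X : Prop := DeqStabrankPolyUniform

/-- The vector encoded by a list of (Clifford circuit, Gaussian-rational coefficient) pairs:
`Σ_j (a_j + i b_j) · C_j |0^t⟩` — literally the approximant appearing in `X`. -/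
def approximant (t : ℕ) (L : List (QCircuit cliffordT t × ℚ × ℚ)) : QReg t → ℂ :=
  (L.map fun x => ((x.2.1 : ℂ) + (x.2.2 : ℂ) * Complex.I) •
      Matrix.mulVec (x.1.toMatrix 0) (zeroState t)).sum

/-- Every listed circuit is an oracle-free, `T`-free (= Clifford) word — conjunct (2) of `X`. -/
def IsCliffordList (t : ℕ) (L : List (QCircuit cliffordT t × ℚ × ℚ)) : Prop :=
  ∀ x ∈ L, x.1.IsOracleFree ∧ x.1.tCount = 0

/-- The output encoding of `X` (lists of (circuit, Gaussian rational)), factored out. -/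
def encodeOut (o : Σ t : ℕ, List (QCircuit cliffordT t × ℚ × ℚ)) : List Bool :=
  boolPair (Computability.encodeNat o.1)
    ((o.2.map fun x => boolPair x.1.encode
        (boolPair (boolPair (encodingIntBool.encode x.2.1.num) (Computability.encodeNat x.2.1.den))
          (boolPair (encodingIntBool.encode x.2.2.num) (Computability.encodeNat x.2.2.den)))).foldr
      boolPair [])

/-- The input encoding of `X`: unary `(t, k)`. -/
def encodeIn (p : ℕ × ℕ) : List Bool :=
  boolPair (Computability.unaryEncodeNat p.1) (Computability.unaryEncodeNat p.2)

/-- Read-back check: `X` is literally "∃ D, PolyTimeComputable encodeIn encodeOut (t,k ↦ ⟨t, D t k⟩) ∧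
Clifford lists ∧ error ≤ 1/(k+1)²" in the factored vocabulary (definitional, `Iff.rfl`). -/
theorem X_iff :
    X ↔ ∃ D : (t : ℕ) → ℕ → List (QCircuit cliffordT t × ℚ × ℚ),
      PolyTimeComputable encodeIn encodeOut (fun p : ℕ × ℕ => (⟨p.1, D p.1 p.2⟩ : Σ t : ℕ, List (QCircuit cliffordT t × ℚ × ℚ))) ∧
      (∀ t k, IsCliffordList t (D t k)) ∧
      ∀ t k, normSq (tensorPow magicT t - approximant t (D t k)) ≤ (1 / ((k : ℝ) + 1)) ^ 2 :=
  Iff.rfl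

/-! ## D1 — the UNIFORMITY bridge: `X ⇐ T ∧ (T → X)`, `T` = the printed (non-uniform) heresy -/

/-- `T` (list form): jointly-polynomial NON-UNIFORM approximate stabilizer decompositions of `|T⟩^{⊗t}`
with Gaussian-rational coefficients — the hypothesis print calls a heresy (BBCCGH19 p.6; PSV22 p.4),
minus the `PolyTimeComputable` clause of `X`. -/
def NonUniformPolyDecomp : Prop :=
  ∃ c : ℕ, ∀ t k : ℕ, ∃ L : List (QCircuit cliffordT t × ℚ × ℚ),
    L.length ≤ (t + k + 2) ^ c ∧ IsCliffordList t L ∧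
    normSq (tensorPow magicT t - approximant t L) ≤ (1 / ((k : ℝ) + 1)) ^ 2

/-- `T` (rank form, over the landed `approxStabilizerRank`): `χ_{1/(k+1)}(|T⟩^{⊗t}) ≤ (t+k+2)^c`.
Equivalent to the list form up to (i) stabilizer states on `t` wires = Clifford words on `|0^t⟩`
(definition of `stabilizerStates`) and (ii) rounding complex coefficients to Gaussian rationals
(costs a factor 2 in precision, absorbed by `k ↦ 2k+1`). -/
def NonUniformPolyRank : Prop :=
  ∃ c : ℕ, ∀ t k : ℕ, approxStabilizerRank (1 / ((k : ℝ) + 1)) (tensorPow magicT t) ≤ (t + k + 2) ^ c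

/-- The bridge piece of D1: uniformization ("finding the decomposition", PSV22 p.4). -/
def Uniformization : Prop := NonUniformPolyDecomp → X

/-- D1 assembly (b): modus ponens — `trivial_seam`. -/
theorem X_of_D1 (h₁ : NonUniformPolyDecomp) (h₂ : Uniformization) : X := h₂ h₁

/-! ## D2 — the PRECISION axis: `X ⇐ X₁ ∧ (X₁ → X)`, `X₁` = one constant precision -/

/-- `X₁` of D2: the same uniform scheme but only precision `1/2` (squared distance `≤ 1/4`) is demanded
(for `k ≥ 1`; the input still carries `k` so that no machine-composition lemma is needed to compare with `X`). -/
def ConstPrecisionUniform : Prop :=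
  ∃ D : (t : ℕ) → ℕ → List (QCircuit cliffordT t × ℚ × ℚ),
    PolyTimeComputable encodeIn encodeOut (fun p : ℕ × ℕ => (⟨p.1, D p.1 p.2⟩ : Σ t : ℕ, List (QCircuit cliffordT t × ℚ × ℚ))) ∧
    (∀ t k, IsCliffordList t (D t k)) ∧
    ∀ t k, 1 ≤ k → normSq (tensorPow magicT t - approximant t (D t k)) ≤ 1 / 4

/-- `X → X₁` (D2's first piece is a CONSEQUENCE of `X`: specialise the precision). Together with
Kalra–Sinha 2025 Thm 47 (fidelity amplification: rank `k`, relative error `ε` ⇒ rank `O(αk)`, error `ε/α`,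
by averaging `(I+C)/2` over random `C ∈ {I,H}^{⊗n}` — non-uniform/randomised) the converse holds up to
derandomisation, so `X₁` is a RESTATEMENT of `X`, not a piece of it. -/
theorem constPrecision_of_X (h : X) : ConstPrecisionUniform := by
  obtain ⟨D, hD, hC, hE⟩ := h
  refine ⟨D, hD, hC, fun t k hk => (hE t k).trans ?_⟩
  have hk' : (1 : ℝ) ≤ k := by exact_mod_cast hk
  have h2 : (2 : ℝ) ≤ (k : ℝ) + 1 := by linarith
  have hpos : (0 : ℝ) < (k : ℝ) + 1 := by linarith
  calc (1 / ((k : ℝ) + 1)) ^ 2 ≤ (1 / 2) ^ 2 := by gcongr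
    _ = 1 / 4 := by norm_num

/-- The bridge piece of D2: uniform precision amplification (effective Kalra–Sinha Thm 47). -/
def UniformAmplification : Prop := ConstPrecisionUniform → X

/-- D2 assembly (b): modus ponens — `trivial_seam`. -/
theorem X_of_D2 (h₁ : ConstPrecisionUniform) (h₂ : UniformAmplification) : X := h₂ h₁

/-! ## D3 — RESIDUE slicing: `|T⟩^{⊗t} = Σ_{r<8} Π_r |T⟩^{⊗t}` (phase depends on `|x| mod 8`, PSV22 p.5) -/

/-- The `r`-th residue slice `Π_{|x| ≡ r (mod 8)} |T⟩^{⊗t}`. -/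
def residueSlice (t r : ℕ) : QReg t → ℂ :=
  fun x => if (Finset.univ.filter fun i => x i = true).card % 8 = r then tensorPow magicT t x else 0

/-- Piece `R_r` of D3: P-uniform jointly-polynomial decompositions of the `r`-th slice at precision
`1/(8(k+1))` (so that eight of them sum to precision `1/(k+1)`). -/
def ResidueUniform (r : ℕ) : Prop :=
  ∃ D : (t : ℕ) → ℕ → List (QCircuit cliffordT t × ℚ × ℚ),
    PolyTimeComputable encodeIn encodeOut (fun p : ℕ × ℕ => (⟨p.1, D p.1 p.2⟩ : Σ t : ℕ, List (QCircuit cliffordT t × ℚ × ℚ))) ∧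
    (∀ t k, IsCliffordList t (D t k)) ∧
    ∀ t k, normSq (residueSlice t r - approximant t (D t k)) ≤ (1 / (8 * ((k : ℝ) + 1))) ^ 2

/-- D3 assembly as a STATEMENT (concatenate the eight machines' outputs; triangle inequality for
`‖·‖ = √normSq`; a `TimeComputable` pairing lemma). Provable in principle; NOT proved here, because D3
already fails (c) in substance: `ResidueUniform 0` for all `t` gives every `ResidueUniform r`
(postselecting the last `8 - r` wires of the `(t + 8 - r)`-qubit slice on `|1⟩` is rank-non-increasing and
shifts the residue), hence gives `X` on its own. -/
def D3Assembly : Prop := (∀ r, r < 8 → ResidueUniform r) → X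

/-! ## D4 — SPAN + COEFFICIENTS: a uniform family of Clifford words whose span is close, then
coefficient extraction -/

/-- Output encoding for lists of circuits only. -/
def encodeOutCirc (o : Σ t : ℕ, List (QCircuit cliffordT t)) : List Bool :=
  boolPair (Computability.encodeNat o.1) ((o.2.map fun C => C.encode).foldr boolPair [])

/-- `X₁` of D4: a P-uniform polynomial family of Clifford words `S(t,k)` whose COMPLEX span contains a
point within `1/(2(k+1))` of `|T⟩^{⊗t}` (coefficients existential, possibly transcendental / huge). -/
def UniformSpan : Prop :=
  ∃ S : (t : ℕ) → ℕ → List (QCircuit cliffordT t),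
    PolyTimeComputable encodeIn encodeOutCirc (fun p : ℕ × ℕ => (⟨p.1, S p.1 p.2⟩ : Σ t : ℕ, List (QCircuit cliffordT t))) ∧
    (∀ t k, ∀ C ∈ S t k, C.IsOracleFree ∧ C.tCount = 0) ∧
    ∀ t k, ∃ a : List ℂ, normSq (tensorPow magicT t -
        (List.zipWith (fun (C : QCircuit cliffordT t) (z : ℂ) => z • Matrix.mulVec (C.toMatrix 0) (zeroState t)) (S t k) a).sum)
      ≤ (1 / (2 * ((k : ℝ) + 1))) ^ 2

/-- The bridge piece of D4: P-uniform COEFFICIENT EXTRACTION (Gram matrix by Aaronson–Gottesman inner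
products is poly-time; the overlaps `⟨C_j 0^t | T^{⊗t}⟩` are Clifford+`T` amplitudes — `GapP`-hard to the
exponential precision that the necessarily exponentially large coefficients (stabilizer-fidelity
multiplicativity, Kalra–Sinha 2025 Thm 2) demand). -/
def CoefficientExtraction : Prop := UniformSpan → X

/-- D4 assembly (b): modus ponens — `trivial_seam`. -/
theorem X_of_D4 (h₁ : UniformSpan) (h₂ : CoefficientExtraction) : X := h₂ h₁

/-! ## D0 — the degenerate pattern every split of a believed-false `X` falls into -/

/-- For ANY proposition `A`, `X ⇐ (A ∨ X) ∧ (¬A ∨ X)`: two pieces, neither giving `X` by itself for a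
well-chosen open `A`, assembly proved — and worthless: the "plan" for piece 1 is a plan for `A`, the plan
for piece 2 a plan for `¬A`. Recorded so that the `trivial_seam` flag has a named witness. -/
theorem X_of_D0 (A : Prop) (h₁ : A ∨ X) (h₂ : ¬A ∨ X) : X := by
  rcases h₁ with hA | hX
  · rcases h₂ with hnA | hX
    · exact absurd hA hnA
    · exact hX
  · exact hX

/-- The instance of D0 with `A := DeqNegStabrankSuperpoly` (the route's kill crux 0247): piece 1
`K ∨ X` HAS a live programme (prove `K`: MT24 transfer with structured targets, ex-FermionicMagic), piece 2
`¬K ∨ X` is the non-uniform heresy again; the two "plans" are mutually destructive (landing `K` refutes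
`X` via the refuter's `KillGlue`, evidence on stmt-1036). -/
theorem X_of_kill_dichotomy (h₁ : DeqNegStabrankSuperpoly ∨ X) (h₂ : ¬DeqNegStabrankSuperpoly ∨ X) : X :=
  X_of_D0 _ h₁ h₂

end Summit.QuantumAdvantage.QuantumAdvantage.Cruxes.DeqStabrankPolyUniform.Census

end
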